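import Summits.QuantumFields.BalabanUV.T4Continuum.Support.T4TrajectoryDensityGated

/-!
# `T4Continuum.T4TrajectoryDensityAssembly` — the function-level `hP` of the gated per-family capstone ASSEMBLED under the
# history: birth slices of every live generation are carried step by step (part 2 §6), the centred perturbation slice of each
# met component is the fresh sum over its live generations (§10), and the budget needed at each step is read off the gate —
# one strong induction on the step, all families at once (cell `pub-balaban`, sub-cell `t4`, spine estimate NE1′ (node O3b/H2),
# lineage t4-ne1p-p1 = PROVER seat P1 «RG-trajectory comparison», generation 22; tree target
# `Summits/QuantumFields/BalabanUV/T4Continuum/Support/`; ADDITIVE — imports `T4TrajectoryDensityGated` ONLY)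

HONEST FRAMING.  Finite four-torus, rung (B)+1 only — NOT infinite volume, NOT a mass gap, NOT the Clay problem, NOT summit
progress.  «continuum YM on T⁴ ⇐ BetaPertH ∧ nine spine estimates (0/9 proved); BetaPertH ⇐ (D1) ∧ (D4) ∧ CAP+tail; G-an2-4
gates asym, D1 and NE2/3/4».  [folklore] kernel (one induction over the lineage's own one-step lemmas `birthSlice_wOp_shift_dressed`,
`pertSlice_fresh`, `pertSlice_fresh_sum`, `wOp_expWeight_add_zconst`), 0 sorry, 0 citations; every window, weight, radius,
defect and count is a HYPOTHESIS about the cell's instantiation — nothing of Bałaban's densities or the cell's D-terms is asserted.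

CONTENTS (§22, the item left open by `T4TrajectoryDensityGated`'s header).  Data beyond the gated capstone's: per met component
`(b, k)` the finset `S k b` of its live GENERATIONS `p = (f, k″)` (`birthScale f ≤ k″ ≤ k`), the source factor `c b k`, a reference
fluctuation `z₁ b k`, a margin radius `ϱ₁ b k`; per generation its current slice radius `rs f k″ k` (`= r` at birth, `= ϱ f k″ k`
after the step `k`) and size `Asz f k″ k` (`= gen f k″` at birth, `× e^{3(s f k + s1 f k)}` per step — part 2 §8's law, as
EQUALITIES the instantiation defines), the transverse fresh defects `δf b k p`, and the step budget `s1 b k :=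
‖c b k‖·Σ_{p∈S k b} 4·Asz p.1 p.2 k / rs p.1 p.2 k · δf b k p`.  Hypotheses: the centred exponent of the component IS the fresh sum
over its live generations (`hQ`), cross-family nesting / complex margin / fresh-pair admissibility / measurability between the
transported family's fine window and every live generation's current window ((w3)⁺, (I4′)), radii ordered
(`ϱ f k″ k < rs f k″ k`, `ϱ b k′ k < ϱ₁ b k ≤ rs p.1 p.2 k`), and THE GATE IMPLIES THE BUDGET (`Gate k → s b k + s1 b k ≤ 1`, e.g.
`Gate := budgetGate …` of §20 with `s1 ≤ m·Σ envVar`).  Results: `pertSlice_component` (one component, one step: slices of the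
live generations ⟹ the centred perturbation slice, size `s1`), **`slices_under_history`** (∀ `k ≤ K` under `RanBelow Gate k`:
every live generation `(f, k″)` has a birth slice on `𝒦 f k″ k` of radius `rs f k″ k` and size `Asz f k″ k ≥ 0`), and
**`pertSlice_under_history`** — EXACTLY the binder `hP` of `transportsFromVar_of_centredExponent_lattice_fam_gated` with
`s₁ := s1`.  With §20 (`hs_of_budgetGate`, `dressedBudget_closed`) this closes the (w2-obs) line at function AND booking level:
no packaged hypothesis remains; what remains are the wall binders themselves ((w1) births `hsl`, (w2-act) `hB`/`hE`, (w3)⁺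
geometry, (I4′) `hpairx`/`hrate`, (w5)/(w7) booking data, (w6) smallness).
-/

namespace Summit.QuantumFields.BalabanUV.T4Continuum.T4TrajectoryDensityDressed

open MeasureTheory Set Metric Filter Finset
open Literature.MathematicalPhysics.QuantumFieldTheory.Balaban1983to89
open T4TermFormat T4TermFormat.Booking T4GatedBooking T4TrajectoryComparison T4TrajectoryModulus
open T4BirthChartTransport (GaugeInvariant BirthSlice RelGauge)
open T4BlockTransport (Fld NDir latMove latN latMove_zero)
open T4TrajectoryDensity

noncomputable section

section Assembly

variable {R : Type*} [NormedRing R] [NormedAlgebra ℂ R] [MeasurableSpace R] {d : ℕ}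

/-- **ONE COMPONENT, ONE STEP: THE CENTRED PERTURBATION SLICE FROM THE LIVE GENERATIONS' SLICES.**  Live generations `i ∈ S`
with gauge-invariant carried terms `G i` having birth slices (`𝒦big i`, radius `r i ≥ ϱ₁ > ϱ`, size `A i ≥ 0`), the fine
window `𝒦` nested into every `𝒦big i` along the fluctuations (a.e.) and along the complex chart motions of radius `ϱ₁` shifted by
`z₁`, fresh pairs in relative gauge of defect `δ i ≤ w`, measurability ⟹ the centred exponent `c·Σ_i (G_i (U+z) − G_i (U+z₁))` is
a perturbation slice on `𝒦` of radius `ϱ` and size `‖c‖·Σ_i 4 A_i / r_i · δ_i` (§10 `pertSlice_fresh` per generation +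
`pertSlice_fresh_sum`). [folklore] -/
theorem pertSlice_component {ι : Type*} (S : Finset ι) {G : ι → Fld d R → ℂ} {rel : ι → Fld d R → Fld d R → Prop}
    {μ : Measure (Fld d R)} {𝒦 : Set (Fld d R)} {𝒦big : ι → Set (Fld d R)} {D : Set (Fld d R)} {z₁ : Fld d R}
    {w ϱ ϱ₁ : ℝ} {r A δ : ι → ℝ} (c : ℂ)
    (hinv : ∀ i ∈ S, GaugeInvariant (rel i) (G i))
    (hsl : ∀ i ∈ S, BirthSlice (G i) latMove latN (𝒦big i) w (r i) (A i))
    (hr : ∀ i ∈ S, ϱ₁ ≤ r i) (hA : ∀ i ∈ S, 0 ≤ A i) (hϱ : ϱ < ϱ₁) (hϱ₁ : 0 < ϱ₁)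
    (hDμ : ∀ᵐ z ∂μ, z ∈ D) (hN1 : ∀ i ∈ S, ∀ z ∈ D, ∀ U₀ ∈ 𝒦, U₀ + z ∈ 𝒦big i)
    (hN2c : ∀ i ∈ S, ∀ U₀ ∈ 𝒦, ∀ p : NDir d R, 0 < latN p → latN p ≤ w →
      ∀ t ∈ tube (ϱ₁ / latN p), latMove U₀ p t + z₁ ∈ 𝒦big i)
    (hpair : ∀ i ∈ S, ∀ U₀ ∈ 𝒦, ∀ p : NDir d R, 0 < latN p → latN p ≤ w →
      ∀ᵐ z ∂μ, ∀ t ∈ tube (ϱ₁ / latN p), RelGauge (rel i) latMove latN (latMove U₀ p t + z₁) (latMove U₀ p t + z) (δ i))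
    (hδw : ∀ i ∈ S, δ i ≤ w) (hmeas : ∀ i ∈ S, ∀ U, AEStronglyMeasurable (fun z => G i (U + z)) μ) :
    PertSlice (fun U z => c * ∑ i ∈ S, (G i (U + z) - G i (U + z₁))) μ latMove latN 𝒦 w ϱ
      (‖c‖ * ∑ i ∈ S, 4 * A i / r i * δ i) :=
  pertSlice_fresh_sum S c fun i hi =>
    pertSlice_fresh latMove_add_right latMove_zero (hinv i hi) (hsl i hi) (lt_of_lt_of_le hϱ₁ (hr i hi)) (hA i hi) hϱ hϱ₁
      (hr i hi) (hDμ.mono fun z hz U₀ hU₀ => hN1 i hi z hz U₀ hU₀) (hN2c i hi) (hpair i hi) (hδw i hi) (hmeas i hi)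

variable {B : Booking} {T : Trajectory B}

/-- **SLICES OF EVERY LIVE GENERATION UNDER THE HISTORY** (strong induction on the step, all families at once).  Births
`hsl` (size `gen`, radius `r`); the dressed step law `hFn`; per-component action data `hB`/`hE`; the centred exponent of each
component = the fresh sum over its live generations (`hQ`); the size/radius recursions `hAsz_*`/`hrs_*` and the budget
definition `hs1`; radii ordered; own and cross-family nesting, complex margins, fresh pairs, measurability; and the gate
implying the budget ⟹ for every `k ≤ K` under `RanBelow Gate k`, every generation `(f, k″)` alive at `k` has
`0 ≤ Asz f k″ k` and `BirthSlice (Fn f k″ k) latMove latN (𝒦 f k″ k) w (rs f k″ k) (Asz f k″ k)`. [folklore] -/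
theorem slices_under_history {Gate : ℕ → Prop} {Fn : B.Birth → ℕ → ℕ → Fld d R → ℂ}
    {rel : B.Birth → ℕ → ℕ → Fld d R → Fld d R → Prop} {𝒦 : B.Birth → ℕ → ℕ → Set (Fld d R)}
    {ref : B.Birth → ℕ → Fld d R → Fld d R} {base : B.Birth → ℕ → Fld d R → ℝ}
    {𝒜 𝒬 : B.Birth → ℕ → Fld d R → Fld d R → ℂ} {q : B.Birth → ℕ → Fld d R → ℂ}
    {μ : B.Birth → ℕ → Measure (Fld d R)} {z₀ z₁ : B.Birth → ℕ → Fld d R} {D : B.Birth → ℕ → Set (Fld d R)}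
    {w r : ℝ} {s s1 ϱ₁ : B.Birth → ℕ → ℝ} {ϱ rs Asz : B.Birth → ℕ → ℕ → ℝ}
    {S : ℕ → B.Birth → Finset (B.Birth × ℕ)} {c : B.Birth → ℕ → ℂ} {δf : B.Birth → ℕ → B.Birth × ℕ → ℝ}
    (hsl : ∀ (b : B.Birth) (k' : ℕ), B.birthScale b ≤ k' → k' ≤ B.K → RanBelow Gate k' →
      BirthSlice (Fn b k' k') latMove latN (𝒦 b k' k') w r (T.gen b k'))
    (hFn : ∀ (b : B.Birth) (k' k : ℕ), B.birthScale b ≤ k' → k' ≤ k → k + 1 ≤ B.K → RanBelow Gate (k + 1) →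
      ∀ U, Fn b k' (k + 1) U =
        wOp (expWeight (base b k) (𝒜 b k + 𝒬 b k)) (μ b k) (z₀ b k) U (fun z => Fn b k' k (U + z)))
    (hB : ∀ (b : B.Birth) (k' k : ℕ), B.birthScale b ≤ k' → k' ≤ k → k + 1 ≤ B.K → RanBelow Gate (k + 1) →
      RealBaseAt (ref b k) (base b k) (𝒜 b k) (μ b k) (𝒦 b k' (k + 1)))
    (hE : ∀ (b : B.Birth) (k' k : ℕ), B.birthScale b ≤ k' → k' ≤ k → k + 1 ≤ B.K → RanBelow Gate (k + 1) →
      ExponentSliceAt (ref b k) (𝒜 b k) (μ b k) latMove latN (𝒦 b k' (k + 1)) w (ϱ b k' k) (s b k))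
    (hQ : ∀ b k, (fun U z => 𝒬 b k U z - q b k U) =
      fun U z => c b k * ∑ p ∈ S k b, (Fn p.1 p.2 k (U + z) - Fn p.1 p.2 k (U + z₁ b k)))
    (hS : ∀ k b, ∀ p ∈ S k b, B.birthScale p.1 ≤ p.2 ∧ p.2 ≤ k)
    (hs1 : ∀ b k, s1 b k = ‖c b k‖ * ∑ p ∈ S k b, 4 * Asz p.1 p.2 k / rs p.1 p.2 k * δf b k p)
    (hAsz_birth : ∀ f k'', Asz f k'' k'' = T.gen f k'') (hrs_birth : ∀ f k'', rs f k'' k'' = r)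
    (hAsz_step : ∀ f k'' k, B.birthScale f ≤ k'' → k'' ≤ k →
      Asz f k'' (k + 1) = Real.exp (3 * (s f k + s1 f k)) * Asz f k'' k)
    (hrs_step : ∀ f k'' k, B.birthScale f ≤ k'' → k'' ≤ k → rs f k'' (k + 1) = ϱ f k'' k)
    (hrs_dec : ∀ f k'' k, B.birthScale f ≤ k'' → k'' ≤ k → ϱ f k'' k < rs f k'' k)
    (hmargin : ∀ (b : B.Birth) (k' k : ℕ), B.birthScale b ≤ k' → k' ≤ k →
      ϱ b k' k < ϱ₁ b k ∧ 0 < ϱ₁ b k ∧ ∀ p ∈ S k b, ϱ₁ b k ≤ rs p.1 p.2 k)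
    (hDμ : ∀ b k, ∀ᵐ z ∂μ b k, z ∈ D b k)
    (hN1 : ∀ (b : B.Birth) (k' k : ℕ), B.birthScale b ≤ k' → k' ≤ k → k + 1 ≤ B.K →
      ∀ z ∈ D b k, ∀ U ∈ 𝒦 b k' (k + 1), U + z ∈ 𝒦 b k' k)
    (hN1x : ∀ (b : B.Birth) (k' k : ℕ), B.birthScale b ≤ k' → k' ≤ k →
      ∀ p ∈ S k b, ∀ z ∈ D b k, ∀ U ∈ 𝒦 b k' (k + 1), U + z ∈ 𝒦 p.1 p.2 k)
    (hN2cx : ∀ (b : B.Birth) (k' k : ℕ), B.birthScale b ≤ k' → k' ≤ k →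
      ∀ p ∈ S k b, ∀ U₀ ∈ 𝒦 b k' (k + 1), ∀ pd : NDir d R, 0 < latN pd → latN pd ≤ w →
        ∀ t ∈ tube (ϱ₁ b k / latN pd), latMove U₀ pd t + z₁ b k ∈ 𝒦 p.1 p.2 k)
    (hpairx : ∀ (b : B.Birth) (k' k : ℕ), B.birthScale b ≤ k' → k' ≤ k →
      ∀ p ∈ S k b, ∀ U₀ ∈ 𝒦 b k' (k + 1), ∀ pd : NDir d R, 0 < latN pd → latN pd ≤ w →
        ∀ᵐ z ∂μ b k, ∀ t ∈ tube (ϱ₁ b k / latN pd),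
          RelGauge (rel p.1 p.2 k) latMove latN (latMove U₀ pd t + z₁ b k) (latMove U₀ pd t + z) (δf b k p))
    (hδfw : ∀ b k, ∀ p ∈ S k b, δf b k p ≤ w)
    (hinv : ∀ b k' k, GaugeInvariant (rel b k' k) (Fn b k' k))
    (hmeas : ∀ (b f : B.Birth) (k'' k : ℕ) (U : Fld d R), AEStronglyMeasurable (fun z => Fn f k'' k (U + z)) (μ b k))
    (hbudget : ∀ k, k < B.K → Gate k → ∀ b : B.Birth, B.birthScale b ≤ k → s b k + s1 b k ≤ 1) :
    ∀ k, k ≤ B.K → RanBelow Gate k → ∀ (f : B.Birth) (k'' : ℕ), B.birthScale f ≤ k'' → k'' ≤ k →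
      0 ≤ Asz f k'' k ∧ BirthSlice (Fn f k'' k) latMove latN (𝒦 f k'' k) w (rs f k'' k) (Asz f k'' k) := by
  -- exact recentring of the step law
  have e : ∀ b k, 𝒜 b k + 𝒬 b k = (𝒜 b k + fun U z => 𝒬 b k U z - q b k U) + fun U _ => q b k U := fun b k => by
    funext U z
    simp only [Pi.add_apply]
    ring
  intro k
  induction k with
  | zero =>
    intro hK hran f k'' hf hk''
    obtain rfl : k'' = 0 := Nat.le_zero.mp hk''
    rw [hAsz_birth, hrs_birth]
    exact ⟨T.gen_nonneg f 0, hsl f 0 hf hK hran⟩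
  | succ k ih =>
    intro hK hran f k'' hf hk''
    rcases Nat.lt_or_eq_of_le hk'' with hlt | heq
    · have hk''k : k'' ≤ k := Nat.lt_succ_iff.mp hlt
      have hkK : k < B.K := Nat.lt_of_succ_le hK
      have IH := ih hkK.le (hran.mono k.le_succ)
      -- budget of step `k` for family `f`, read off the gate
      have hsk : s f k + s1 f k ≤ 1 := hbudget k hkK (hran k (Nat.lt_succ_self k)) f (hf.trans hk''k)
      -- the centred perturbation slice of `f`'s component at step `k`, from the live generations' slices (IH)
      have hPk : PertSlice (fun U z => 𝒬 f k U z - q f k U) (μ f k) latMove latN (𝒦 f k'' (k + 1)) w (ϱ f k'' k)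
          (s1 f k) := by
        rw [hQ f k, hs1 f k]
        obtain ⟨hϱϱ₁, hϱ₁0, hϱ₁r⟩ := hmargin f k'' k hf hk''k
        exact pertSlice_component (S k f) (c f k) (fun p _ => hinv p.1 p.2 k)
          (fun p hp => (IH p.1 p.2 (hS k f p hp).1 (hS k f p hp).2).2) hϱ₁r
          (fun p hp => (IH p.1 p.2 (hS k f p hp).1 (hS k f p hp).2).1) hϱϱ₁ hϱ₁0 (hDμ f k)
          (hN1x f k'' k hf hk''k) (hN2cx f k'' k hf hk''k) (hpairx f k'' k hf hk''k) (hδfw f k)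
          (fun p _ U => hmeas f p.1 p.2 k U)
      -- one dressed step of the generation `(f, k'')` itself
      have hstep := birthSlice_wOp_shift_dressed (z₀ := z₀ f k) latMove_add_right (hB f k'' k hf hk''k hK hran)
        (hE f k'' k hf hk''k hK hran) hPk hsk (IH f k'' hf hk''k).2
        ((hDμ f k).mono fun z hz U hU => hN1 f k'' k hf hk''k hK z hz U hU) (fun U => hmeas f f k'' k U)
        (hrs_dec f k'' k hf hk''k) (IH f k'' hf hk''k).1
      have eFn : Fn f k'' (k + 1) = fun U => wOp (expWeight (base f k) (𝒜 f k + fun U z => 𝒬 f k U z - q f k U))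
          (μ f k) (z₀ f k) U (fun z => Fn f k'' k (U + z)) := by
        funext U
        rw [hFn f k'' k hf hk''k hK hran U, e f k, wOp_expWeight_add_zconst]
      rw [hAsz_step f k'' k hf hk''k, hrs_step f k'' k hf hk''k, eFn]
      exact ⟨mul_nonneg (Real.exp_pos _).le (IH f k'' hf hk''k).1, hstep⟩
    · subst heq
      rw [hAsz_birth, hrs_birth]
      exact ⟨T.gen_nonneg f (k + 1), hsl f (k + 1) hf hK hran⟩

/-- **THE BINDER `hP` OF THE GATED PER-FAMILY CAPSTONE, DISCHARGED** — under the history `RanBelow Gate (k+1)` the centred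
perturbation slice of the component of family `b` at step `k` holds on the fine window `𝒦 b k′ (k+1)` with radius `ϱ b k′ k`
and size `s1 b k` (= `‖c b k‖·Σ_{p∈S k b} 4·Asz p.1 p.2 k / rs p.1 p.2 k · δf b k p`): `slices_under_history` at step `k` +
`pertSlice_component`.  This is EXACTLY the `hP` of `transportsFromVar_of_centredExponent_lattice_fam_gated` with `s₁ := s1`;
its `hs` is `hbudget` read under the history (with `Gate := budgetGate …`, `hs_of_budgetGate`). [folklore] -/
theorem pertSlice_under_history {Gate : ℕ → Prop} {Fn : B.Birth → ℕ → ℕ → Fld d R → ℂ}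
    {rel : B.Birth → ℕ → ℕ → Fld d R → Fld d R → Prop} {𝒦 : B.Birth → ℕ → ℕ → Set (Fld d R)}
    {ref : B.Birth → ℕ → Fld d R → Fld d R} {base : B.Birth → ℕ → Fld d R → ℝ}
    {𝒜 𝒬 : B.Birth → ℕ → Fld d R → Fld d R → ℂ} {q : B.Birth → ℕ → Fld d R → ℂ}
    {μ : B.Birth → ℕ → Measure (Fld d R)} {z₀ z₁ : B.Birth → ℕ → Fld d R} {D : B.Birth → ℕ → Set (Fld d R)}
    {w r : ℝ} {s s1 ϱ₁ : B.Birth → ℕ → ℝ} {ϱ rs Asz : B.Birth → ℕ → ℕ → ℝ}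
    {S : ℕ → B.Birth → Finset (B.Birth × ℕ)} {c : B.Birth → ℕ → ℂ} {δf : B.Birth → ℕ → B.Birth × ℕ → ℝ}
    (hsl : ∀ (b : B.Birth) (k' : ℕ), B.birthScale b ≤ k' → k' ≤ B.K → RanBelow Gate k' →
      BirthSlice (Fn b k' k') latMove latN (𝒦 b k' k') w r (T.gen b k'))
    (hFn : ∀ (b : B.Birth) (k' k : ℕ), B.birthScale b ≤ k' → k' ≤ k → k + 1 ≤ B.K → RanBelow Gate (k + 1) →
      ∀ U, Fn b k' (k + 1) U =
        wOp (expWeight (base b k) (𝒜 b k + 𝒬 b k)) (μ b k) (z₀ b k) U (fun z => Fn b k' k (U + z)))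
    (hB : ∀ (b : B.Birth) (k' k : ℕ), B.birthScale b ≤ k' → k' ≤ k → k + 1 ≤ B.K → RanBelow Gate (k + 1) →
      RealBaseAt (ref b k) (base b k) (𝒜 b k) (μ b k) (𝒦 b k' (k + 1)))
    (hE : ∀ (b : B.Birth) (k' k : ℕ), B.birthScale b ≤ k' → k' ≤ k → k + 1 ≤ B.K → RanBelow Gate (k + 1) →
      ExponentSliceAt (ref b k) (𝒜 b k) (μ b k) latMove latN (𝒦 b k' (k + 1)) w (ϱ b k' k) (s b k))
    (hQ : ∀ b k, (fun U z => 𝒬 b k U z - q b k U) =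
      fun U z => c b k * ∑ p ∈ S k b, (Fn p.1 p.2 k (U + z) - Fn p.1 p.2 k (U + z₁ b k)))
    (hS : ∀ k b, ∀ p ∈ S k b, B.birthScale p.1 ≤ p.2 ∧ p.2 ≤ k)
    (hs1 : ∀ b k, s1 b k = ‖c b k‖ * ∑ p ∈ S k b, 4 * Asz p.1 p.2 k / rs p.1 p.2 k * δf b k p)
    (hAsz_birth : ∀ f k'', Asz f k'' k'' = T.gen f k'') (hrs_birth : ∀ f k'', rs f k'' k'' = r)
    (hAsz_step : ∀ f k'' k, B.birthScale f ≤ k'' → k'' ≤ k →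
      Asz f k'' (k + 1) = Real.exp (3 * (s f k + s1 f k)) * Asz f k'' k)
    (hrs_step : ∀ f k'' k, B.birthScale f ≤ k'' → k'' ≤ k → rs f k'' (k + 1) = ϱ f k'' k)
    (hrs_dec : ∀ f k'' k, B.birthScale f ≤ k'' → k'' ≤ k → ϱ f k'' k < rs f k'' k)
    (hmargin : ∀ (b : B.Birth) (k' k : ℕ), B.birthScale b ≤ k' → k' ≤ k →
      ϱ b k' k < ϱ₁ b k ∧ 0 < ϱ₁ b k ∧ ∀ p ∈ S k b, ϱ₁ b k ≤ rs p.1 p.2 k)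
    (hDμ : ∀ b k, ∀ᵐ z ∂μ b k, z ∈ D b k)
    (hN1 : ∀ (b : B.Birth) (k' k : ℕ), B.birthScale b ≤ k' → k' ≤ k → k + 1 ≤ B.K →
      ∀ z ∈ D b k, ∀ U ∈ 𝒦 b k' (k + 1), U + z ∈ 𝒦 b k' k)
    (hN1x : ∀ (b : B.Birth) (k' k : ℕ), B.birthScale b ≤ k' → k' ≤ k →
      ∀ p ∈ S k b, ∀ z ∈ D b k, ∀ U ∈ 𝒦 b k' (k + 1), U + z ∈ 𝒦 p.1 p.2 k)
    (hN2cx : ∀ (b : B.Birth) (k' k : ℕ), B.birthScale b ≤ k' → k' ≤ k →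
      ∀ p ∈ S k b, ∀ U₀ ∈ 𝒦 b k' (k + 1), ∀ pd : NDir d R, 0 < latN pd → latN pd ≤ w →
        ∀ t ∈ tube (ϱ₁ b k / latN pd), latMove U₀ pd t + z₁ b k ∈ 𝒦 p.1 p.2 k)
    (hpairx : ∀ (b : B.Birth) (k' k : ℕ), B.birthScale b ≤ k' → k' ≤ k →
      ∀ p ∈ S k b, ∀ U₀ ∈ 𝒦 b k' (k + 1), ∀ pd : NDir d R, 0 < latN pd → latN pd ≤ w →
        ∀ᵐ z ∂μ b k, ∀ t ∈ tube (ϱ₁ b k / latN pd),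
          RelGauge (rel p.1 p.2 k) latMove latN (latMove U₀ pd t + z₁ b k) (latMove U₀ pd t + z) (δf b k p))
    (hδfw : ∀ b k, ∀ p ∈ S k b, δf b k p ≤ w)
    (hinv : ∀ b k' k, GaugeInvariant (rel b k' k) (Fn b k' k))
    (hmeas : ∀ (b f : B.Birth) (k'' k : ℕ) (U : Fld d R), AEStronglyMeasurable (fun z => Fn f k'' k (U + z)) (μ b k))
    (hbudget : ∀ k, k < B.K → Gate k → ∀ b : B.Birth, B.birthScale b ≤ k → s b k + s1 b k ≤ 1) :
    ∀ (b : B.Birth) (k' k : ℕ), B.birthScale b ≤ k' → k' ≤ k → k + 1 ≤ B.K → RanBelow Gate (k + 1) →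
      PertSlice (fun U z => 𝒬 b k U z - q b k U) (μ b k) latMove latN (𝒦 b k' (k + 1)) w (ϱ b k' k) (s1 b k) := by
  intro b k' k hbk' hk'k hK hran
  have IH := slices_under_history hsl hFn hB hE hQ hS hs1 hAsz_birth hrs_birth hAsz_step hrs_step hrs_dec hmargin hDμ hN1
    hN1x hN2cx hpairx hδfw hinv hmeas hbudget k ((Nat.le_succ k).trans hK) (hran.mono k.le_succ)
  rw [hQ b k, hs1 b k]
  obtain ⟨hϱϱ₁, hϱ₁0, hϱ₁r⟩ := hmargin b k' k hbk' hk'k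
  exact pertSlice_component (S k b) (c b k) (fun p _ => hinv p.1 p.2 k)
    (fun p hp => (IH p.1 p.2 (hS k b p hp).1 (hS k b p hp).2).2) hϱ₁r
    (fun p hp => (IH p.1 p.2 (hS k b p hp).1 (hS k b p hp).2).1) hϱϱ₁ hϱ₁0 (hDμ b k)
    (hN1x b k' k hbk' hk'k) (hN2cx b k' k hbk' hk'k) (hpairx b k' k hbk' hk'k) (hδfw b k)
    (fun p _ U => hmeas b p.1 p.2 k U)

end Assembly

end

end Summit.QuantumFields.BalabanUV.T4Continuum.T4TrajectoryDensityDressed
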